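import Summits.ABC.IUTFork.Cor312ProvenanceLocal
import Summits.ABC.IUTFork.Thm311RealM
import Literature.IUT.LogVolume.PrincipalArithmeticDivisors
import Literature.NumberTheory.EllipticCurves.MultiplicativeReductionJValuationProofs
import HarnessLib

/-!
# [IUTchIII] Cor. 3.12 provenance — `log(q)` of the initial Θ-data read over `F_mod`, and the `q`-pilot local
# log-volume from pieces indexed by `𝕍 ≅ 𝕍_mod` (c312 crew, wave 2, board row W2-F′)

Record-only companion (seat abc-iut-c312-8, gen 2); TAKES NO SIDE on Cor. 3.12. [IUTchIV] Thm. 1.10, kurims p. 23: "`log(q)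
:= deg(𝔮^{F□}_{ADiv})` … for `F□ ∈ {F, F_tpd, F_mod}` … Here, we observe that the various `log(q_{(−)})`'s are independent of
the choice of `F□`". `Cor312Provenance.lean` computed `log(q)` over `F□ = F` (`Cor312Prov.logq D = (1/[F:ℚ])·Σ_{v ∈ 𝕍(F)^bad}
ord_v(q_v)·log N(v)`); the VERBATIM log-volumes of [IUTchIII] are indexed by the section `𝕍 ⥲ 𝕍_mod` of [IUTchI] Def. 3.1
(e) — one summand per place of `F_mod`, with the normalized weights of Rmk. 3.1.1 (ii)
`1/([K_v:(F_mod)_v]·Σ_{w|v_ℚ}[(F_mod)_w:ℚ_{v_ℚ}])` (abc-iut-L6-t4 `packetWeight`), i.e. marginals `[(F_mod)_w:ℚ_p]/[F_mod:ℚ]`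
per place `w` of `F_mod` — so the assembled real setting of abc-iut-c312-5's index `Real.thetaIndexOfInitial D` (`V := V̲`)
needs the `F_mod`-indexed form of the provenance arithmetic. THIS FILE (all PROVED):

* `mem_VFbad_iff_finBelow_mem` — `v ∈ 𝕍(F)^bad ↔ (v ∩ F_mod) ∈ 𝕍^bad_mod` (L5-t2's `VFbad` unfolded through c312-5's
  `Thm311.Real.finBelow`);
* `neg_ord_j_eq_qParamOrd`, **`qParamOrd_eq_ramificationIdx_mul`** — at `v ∈ 𝕍(F)^bad`: `ord_v(q_v) := ord_v(Δ_min) = −ord_v(j_E)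
  = e(v|w)·h_w` with `h_w := −ord_w(j_E)` read in `F_mod = ℚ(j_E) ∋ j_E` and `w = v ∩ F_mod` (Tate: the tree's
  `log_valuation_j_eq_ordMinimalDiscriminant_of_hasMultiplicativeReductionAt`; `ord_algebraMap`);
* **`sum_qTerm_fiber_finBelow`** — per place `w ∈ 𝕍^bad_mod`: `Σ_{v ∈ 𝕍(F)^bad, v | w} ord_v(q_v)·log N(v) = [F:F_mod]·h_w·log N(w)`
  (the fundamental identity `Σ_{v|w} e_v f_v = [F:F_mod]`, c312-3's `sum_pullbackWeight_mul_degWeight_inr`);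
* **`logq_eq_sum_mod`** — `log(q) = (1/[F_mod:ℚ])·Σ_{w ∈ 𝕍^bad_mod} h_w·log N(w)`: the printed independence of `F□`, `F□ = F_mod`;
* `sum_qTerm_fiber_mod` — the same per fibre of any "prime below" map `g_mod` on the places of `F_mod`;
* **`sum_pieces_eq_neg_qFiber_mod`** / **`negLogQ_eq_neg_absLogq_of_pieces_mod`** — the `F_mod`-indexed twin of
  `Cor312ProvenanceLocal`: pieces at `(j, v_ℚ)` lying over places `w` of `F_mod`, weights with marginals
  `Σ_{i over w} wd_i = Pr(w)/[F_mod:ℚ]` (Rmk. 3.1.1 (ii): `Pr(w) = [(F_mod)_w:ℚ_{v_ℚ}]`; any nonzero `Pr`), centres with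
  `n_i = −h_w·log N(w)/(2l·Pr(w))` over bad `w` (the `2l`-th root `q̲_v̲` of the `q`-parameter at `v̲ ∈ 𝕍^bad`: `[(F_mod)_w:ℚ_p]·log‖q̲_v̲‖
  = −(1/2l)·h_w·log N(w)`) and `n_i = 0` over good `w` ⟹ `Σ_i wd_i·n_i` is the `F`-level fibre term of the criterion, hence
  `P.negLogQ = −absLogq D` for a setting whose local `q`-volumes are such sums (`g := g_mod ∘ (· ∩ F_mod)`).
`h_w` is carried as `−ord_w(jm)` for ANY `jm ∈ F_mod` with `jm = j_E` in `F` (hypothesis `hjm`; `F_mod = ℚ(j_E)` is L5-t2's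
`fieldOfModuli`, so `jm = ⟨j_E, _⟩`), no definition introduced. [claim: Mochizuki2012, status: disputed] for every quotation.
-/

noncomputable section

namespace Summit.ABC.IUTFork.Cor312Prov

open Literature.IUT.HodgeTheaters Literature.IUT.LogVolume NumberField IsDedekindDomain
open scoped Classical

variable {F K Fbar : Type} [Field F] [NumberField F] [Field K] [NumberField K]
  [Algebra F K] [Field Fbar] [Algebra F Fbar] [Algebra K Fbar] {E : WeierstrassCurve F} [E.IsElliptic]
  {l : ℕ} {Pb : BadPlacePredicates K}

/-! ## 1. `𝕍(F)^bad` through the place of `F_mod` below -/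

/-- `v ∈ 𝕍(F)^bad = 𝕍^bad_mod ×_{𝕍_mod} 𝕍(F)` iff the place `v ∩ F_mod` of `F_mod` below `v` (c312-5's `Thm311.Real.finBelow`)
lies in `𝕍^bad_mod` ([IUTchI] Def. 3.1 (b); L5-t2's `VFbad` unfolded). PROVED. [claim: Mochizuki2012, status: disputed] -/
theorem mem_VFbad_iff_finBelow_mem (D : InitialThetaData F K Fbar E l Pb) (v : FinitePlace F) :
    v ∈ D.VFbad ↔ Thm311.Real.finBelow (E := E) v ∈ D.VbadMod := by
  show Val.restrict (fieldOfModuli E) (Val.non v) ∈ Val.non '' D.VbadMod ↔ _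
  rw [Thm311.Real.restrict_non_eq_finBelow]
  constructor
  · rintro ⟨w, hw, hwv⟩
    rwa [← Sum.inr_injective hwv]
  · intro h
    exact ⟨_, h, rfl⟩

/-- The maximal ideal of the place below is c312-3's `finBelow` of the maximal ideal (both are `v ∩ 𝓞_{F_mod}`). PROVED.
[claim: Mochizuki2012, status: disputed] -/
theorem maximalIdeal_finBelow (v : FinitePlace F) :
    (Thm311.Real.finBelow (E := E) v).maximalIdeal =
      Literature.IUT.LogVolume.finBelow (fieldOfModuli E) F v.maximalIdeal := by
  unfold Thm311.Real.finBelow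
  rw [FinitePlace.maximalIdeal_mk]
  exact HeightOneSpectrum.ext rfl

/-! ## 2. `ord_v(q_v) = e(v|w)·h_w` at the bad places -/

/-- **Tate at a bad place**: for `v ∈ 𝕍(F)^bad` (multiplicative reduction, [IUTchI] Def. 3.1 (b)), `−ord_v(j_E) = ord_v(q_v)`
(`:= ord_v(Δ_min)`, L5-t2's `qParamOrd`; the tree's `log_valuation_j_eq_ordMinimalDiscriminant_of_hasMultiplicativeReductionAt`,
Silverman AEC VII.5.1 (b)). PROVED. [claim: Mochizuki2012, status: disputed] -/
theorem neg_ord_j_eq_qParamOrd (D : InitialThetaData F K Fbar E l Pb) {v : FinitePlace F} (hv : v ∈ D.VFbad) :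
    -(ord F v.maximalIdeal E.j) = (qParamOrd E v.maximalIdeal : ℤ) := by
  unfold ord qParamOrd
  rw [neg_neg]
  exact E.log_valuation_j_eq_ordMinimalDiscriminant_of_hasMultiplicativeReductionAt v.maximalIdeal
    (D.multiplicative_over_VbadMod v hv)

/-- **`ord_v(q_v) = e(v|w)·h_w`** with `w = v ∩ F_mod` and `h_w := −ord_w(j_E)` read in `F_mod` (`jm ∈ F_mod` any element equal to
`j_E` in `F`): `ord_v(j_E) = e(v|w)·ord_w(j_E)` (the tree's `ord_algebraMap`). PROVED. [claim: Mochizuki2012, status: disputed] -/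
theorem qParamOrd_eq_ramificationIdx_mul (D : InitialThetaData F K Fbar E l Pb) (jm : fieldOfModuli E) (hjm : (jm : F) = E.j)
    {v : FinitePlace F} (hv : v ∈ D.VFbad) :
    (qParamOrd E v.maximalIdeal : ℤ) =
      Ideal.ramificationIdx' (Literature.IUT.LogVolume.finBelow (fieldOfModuli E) F v.maximalIdeal).asIdeal
          v.maximalIdeal.asIdeal *
        -(ord (fieldOfModuli E) (Literature.IUT.LogVolume.finBelow (fieldOfModuli E) F v.maximalIdeal) jm) := by
  rw [← neg_ord_j_eq_qParamOrd D hv, ← hjm]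
  change -(ord F v.maximalIdeal (algebraMap (fieldOfModuli E) F jm)) = _
  rw [ord_algebraMap]
  ring

/-! ## 3. The fibre sums of `ord_v(q_v)·log N(v)` over a place of `F_mod` -/

/-- **Per place `w ∈ 𝕍^bad_mod`: `Σ_{v ∈ 𝕍(F)^bad, v ∩ F_mod = w} ord_v(q_v)·log N(v) = [F:F_mod]·h_w·log N(w)`** — `ord_v(q_v) = e_v·h_w`,
`log N(v) = f_v·log N(w)`, `Σ_{v|w} e_v f_v = [F:F_mod]` (c312-3's `sum_pullbackWeight_mul_degWeight_inr`). PROVED.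
[claim: Mochizuki2012, status: disputed] -/
theorem sum_qTerm_fiber_finBelow (D : InitialThetaData F K Fbar E l Pb) (jm : fieldOfModuli E) (hjm : (jm : F) = E.j)
    {w : FinitePlace (fieldOfModuli E)} (hw : w ∈ D.VbadMod) :
    ∑ v ∈ (vFbad_finite D).toFinset with Thm311.Real.finBelow (E := E) v = w, qTerm (E := E) v =
      (Module.finrank (fieldOfModuli E) F : ℝ) *
        (-(ord (fieldOfModuli E) w.maximalIdeal jm : ℝ) * logNorm (fieldOfModuli E) w.maximalIdeal) := by
  have key := sum_pullbackWeight_mul_degWeight_inr (F := fieldOfModuli E) (K := F) w.maximalIdeal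
  rw [degWeight_inr] at key
  -- reindex the fibre of `w` in `𝕍(F)^bad` by the places of `F` above `w.maximalIdeal`
  have hre : ∑ v ∈ (vFbad_finite D).toFinset with Thm311.Real.finBelow (E := E) v = w, qTerm (E := E) v =
      ∑ x ∈ placesAbove (fieldOfModuli E) F (Sum.inr w.maximalIdeal),
        (-(ord (fieldOfModuli E) w.maximalIdeal jm : ℝ)) *
          ((pullbackWeight (fieldOfModuli E) F x : ℝ) * degWeight F x) := by
    refine Finset.sum_bij (fun v _ => Sum.inr v.maximalIdeal) ?_ ?_ ?_ ?_
    · intro v hv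
      rw [Finset.mem_filter] at hv
      rw [mem_placesAbove_iff]
      change Sum.inr (Literature.IUT.LogVolume.finBelow (fieldOfModuli E) F v.maximalIdeal) =
        (Sum.inr w.maximalIdeal : Place (fieldOfModuli E))
      rw [← maximalIdeal_finBelow (E := E), hv.2]
    · intro v₁ _ v₂ _ h
      exact FinitePlace.maximalIdeal_injective (Sum.inr_injective h)
    · intro x hx
      rcases x with x | x
      · rw [mem_placesAbove_iff] at hx
        exact absurd hx Sum.inl_ne_inr
      · rw [mem_placesAbove_iff] at hx
        have hx' : Literature.IUT.LogVolume.finBelow (fieldOfModuli E) F x = w.maximalIdeal := Sum.inr_injective hx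
        have hfb : Thm311.Real.finBelow (E := E) (FinitePlace.mk x) = w :=
          (FinitePlace.maximalIdeal_inj _ _).mp
            (by rw [maximalIdeal_finBelow (E := E), FinitePlace.maximalIdeal_mk, hx'])
        refine ⟨FinitePlace.mk x, ?_, by rw [FinitePlace.maximalIdeal_mk]⟩
        rw [Finset.mem_filter, Set.Finite.mem_toFinset, mem_VFbad_iff_finBelow_mem, hfb]
        exact ⟨hw, rfl⟩
    · intro v hv
      rw [Finset.mem_filter] at hv
      have hvbad : v ∈ D.VFbad := (vFbad_finite D).mem_toFinset.mp hv.1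
      have hq := qParamOrd_eq_ramificationIdx_mul D jm hjm hvbad
      have hwv : Literature.IUT.LogVolume.finBelow (fieldOfModuli E) F v.maximalIdeal = w.maximalIdeal := by
        rw [← maximalIdeal_finBelow (E := E), hv.2]
      unfold qTerm
      rw [degWeight_inr]
      simp only [pullbackWeight]
      have hq' : (qParamOrd E v.maximalIdeal : ℝ) =
          (Ideal.ramificationIdx' (Literature.IUT.LogVolume.finBelow (fieldOfModuli E) F v.maximalIdeal).asIdeal
              v.maximalIdeal.asIdeal : ℝ) *
            -(ord (fieldOfModuli E) (Literature.IUT.LogVolume.finBelow (fieldOfModuli E) F v.maximalIdeal) jm : ℝ) := by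
        exact_mod_cast hq
      rw [hq', hwv]
      ring
  rw [hre, ← Finset.mul_sum, key]
  ring

/-- `𝕍^bad_mod` is finite (c312-5's `Thm311.Real.vbadMod_finite`), as a `Finset`. [claim: Mochizuki2012, status: disputed] -/
theorem vbadMod_toFinset_mem (D : InitialThetaData F K Fbar E l Pb) (w : FinitePlace (fieldOfModuli E)) :
    w ∈ (Thm311.Real.vbadMod_finite D).toFinset ↔ w ∈ D.VbadMod :=
  Set.Finite.mem_toFinset _

/-- **`log(q)` over `F□ = F_mod`**: `log(q) = (1/[F_mod:ℚ])·Σ_{w ∈ 𝕍^bad_mod} h_w·log N(w)` with `h_w = −ord_w(j_E)` — [IUTchIV] p. 23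
"the various `log(q_{(−)})`'s are independent of the choice of `F□`" for `F□ = F_mod` (Cor. 2.2 (ii): "`E_F` and `F_mod`
arise as the “`E_F`” and “`F_mod`” for a collection of initial Θ-data"). PROVED: regroup `log(q)` along `v ↦ v ∩ F_mod`
(`logq_eq_sum_fiberwise`), fibre sums by `sum_qTerm_fiber_finBelow`, tower law `[F:ℚ] = [F:F_mod]·[F_mod:ℚ]`.
[claim: Mochizuki2012, status: disputed] -/
theorem logq_eq_sum_mod (D : InitialThetaData F K Fbar E l Pb) (jm : fieldOfModuli E) (hjm : (jm : F) = E.j) :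
    logq D = (∑ w ∈ (Thm311.Real.vbadMod_finite D).toFinset,
        -(ord (fieldOfModuli E) w.maximalIdeal jm : ℝ) * logNorm (fieldOfModuli E) w.maximalIdeal) /
      Module.finrank ℚ (fieldOfModuli E) := by
  rw [logq_eq_sum_fiberwise D (Thm311.Real.finBelow (E := E))]
  have himage : (vFbad_finite D).toFinset.image (Thm311.Real.finBelow (E := E)) =
      (Thm311.Real.vbadMod_finite D).toFinset := by
    ext w
    rw [Finset.mem_image, vbadMod_toFinset_mem]
    constructor
    · rintro ⟨v, hv, rfl⟩
      exact (mem_VFbad_iff_finBelow_mem D v).mp ((vFbad_finite D).mem_toFinset.mp hv)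
    · intro hw
      obtain ⟨x, hx⟩ := Thm311.Real.fibre_restrict_nonempty (fieldOfModuli E) (M := F) (Val.non w)
      rcases x with u | v
      · exact absurd hx Sum.inl_ne_inr
      · have hvw : Thm311.Real.finBelow (E := E) v = w := Sum.inr_injective hx
        refine ⟨v, (vFbad_finite D).mem_toFinset.mpr ?_, hvw⟩
        rw [mem_VFbad_iff_finBelow_mem, hvw]
        exact hw
  rw [himage]
  have hsum : ∑ w ∈ (Thm311.Real.vbadMod_finite D).toFinset,
      ∑ v ∈ (vFbad_finite D).toFinset with Thm311.Real.finBelow (E := E) v = w, qTerm (E := E) v =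
      (Module.finrank (fieldOfModuli E) F : ℝ) * ∑ w ∈ (Thm311.Real.vbadMod_finite D).toFinset,
        -(ord (fieldOfModuli E) w.maximalIdeal jm : ℝ) * logNorm (fieldOfModuli E) w.maximalIdeal := by
    rw [Finset.mul_sum]
    refine Finset.sum_congr rfl fun w hw => ?_
    exact sum_qTerm_fiber_finBelow D jm hjm ((vbadMod_toFinset_mem D w).mp hw)
  rw [hsum, finrank_rat_eq_mul (F := fieldOfModuli E) (K := F)]
  have hF : (0 : ℝ) < Module.finrank (fieldOfModuli E) F := by exact_mod_cast Module.finrank_pos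
  have hM : (0 : ℝ) < Module.finrank ℚ (fieldOfModuli E) := by exact_mod_cast Module.finrank_pos
  field_simp

/-- **Fibres of a "prime below" map on the places of `F_mod`**: for `g_mod : 𝕍(F_mod)^non → κ` and `k : κ`,
`Σ_{v ∈ 𝕍(F)^bad, g_mod(v ∩ F_mod) = k} ord_v(q_v)·log N(v) = [F:F_mod]·Σ_{w ∈ 𝕍^bad_mod, g_mod w = k} h_w·log N(w)`. PROVED.
[claim: Mochizuki2012, status: disputed] -/
theorem sum_qTerm_fiber_mod (D : InitialThetaData F K Fbar E l Pb) (jm : fieldOfModuli E) (hjm : (jm : F) = E.j)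
    {κ : Type*} [DecidableEq κ] (gm : FinitePlace (fieldOfModuli E) → κ) (k : κ) :
    ∑ v ∈ (vFbad_finite D).toFinset with gm (Thm311.Real.finBelow (E := E) v) = k, qTerm (E := E) v =
      (Module.finrank (fieldOfModuli E) F : ℝ) *
        ∑ w ∈ (Thm311.Real.vbadMod_finite D).toFinset with gm w = k,
          -(ord (fieldOfModuli E) w.maximalIdeal jm : ℝ) * logNorm (fieldOfModuli E) w.maximalIdeal := by
  -- regroup the `F`-side fibre along `v ↦ v ∩ F_mod` over the `F_mod`-side fibre
  have hmaps : ∀ v ∈ (vFbad_finite D).toFinset.filter (fun v => gm (Thm311.Real.finBelow (E := E) v) = k),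
      Thm311.Real.finBelow (E := E) v ∈ (Thm311.Real.vbadMod_finite D).toFinset.filter (fun w => gm w = k) := by
    intro v hv
    rw [Finset.mem_filter] at hv ⊢
    exact ⟨(vbadMod_toFinset_mem D _).mpr
      ((mem_VFbad_iff_finBelow_mem D v).mp ((vFbad_finite D).mem_toFinset.mp hv.1)), hv.2⟩
  rw [← Finset.sum_fiberwise_of_maps_to hmaps, Finset.mul_sum]
  refine Finset.sum_congr rfl fun w hw => ?_
  rw [Finset.mem_filter] at hw
  have hfilt : ((vFbad_finite D).toFinset.filter (fun v => gm (Thm311.Real.finBelow (E := E) v) = k)).filter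
      (fun v => Thm311.Real.finBelow (E := E) v = w) =
      (vFbad_finite D).toFinset.filter (fun v => Thm311.Real.finBelow (E := E) v = w) := by
    ext v
    simp only [Finset.mem_filter]
    constructor
    · rintro ⟨⟨h1, -⟩, h3⟩; exact ⟨h1, h3⟩
    · rintro ⟨h1, h3⟩; exact ⟨⟨h1, by rw [h3]; exact hw.2⟩, h3⟩
  rw [hfilt, sum_qTerm_fiber_finBelow D jm hjm ((vbadMod_toFinset_mem D w).mp hw.1)]

/-! ## 4. The `q`-pilot local log-volume from pieces indexed by places of `F_mod` -/

/-- **Weighted pieces over the places of `F_mod` in one fibre** (the [IUTchIII] indexing by `𝕍 ≅ 𝕍_mod`): pieces `i : I` at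
`k`, each over a place `π i` of `F_mod` with `g_mod (π i) = k`, "weight × degree" `wd i` with the Rmk. 3.1.1 (ii) marginals
`Σ_{i over w} wd_i = Pr(w)/[F_mod:ℚ]` at every bad `w` of the fibre (`Pr(w) ≠ 0`; print: `Pr(w) = [(F_mod)_w:ℚ_{v_ℚ}]`), centre
log-norms `n_i = −h_w·log N(w)/(2l·Pr(w))` over bad `w` (`h_w = −ord_w(j_E)`: the `2l`-th root of the `q`-parameter) and `0` over
good `w`: then `Σ_i wd_i·n_i = −(Σ_{v ∈ 𝕍(F)^bad, g_mod(v ∩ F_mod) = k} ord_v(q_v)·log N(v))/(2l·[F:ℚ])` — the `F`-level fibre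
term of the criterion `negLogQ_eq_neg_absLogq_of_local` (with `g := g_mod ∘ (· ∩ F_mod)`). PROVED.
[claim: Mochizuki2012, status: disputed] -/
theorem sum_pieces_eq_neg_qFiber_mod (D : InitialThetaData F K Fbar E l Pb) (jm : fieldOfModuli E)
    (hjm : (jm : F) = E.j) {κ : Type*} [DecidableEq κ] (gm : FinitePlace (fieldOfModuli E) → κ) (k : κ)
    {I : Type*} [Fintype I] (π : I → FinitePlace (fieldOfModuli E)) (hπ : ∀ i, gm (π i) = k)
    (wd n : I → ℝ) (Pr : FinitePlace (fieldOfModuli E) → ℝ) (hPr : ∀ w ∈ D.VbadMod, Pr w ≠ 0)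
    (hmarg : ∀ w ∈ D.VbadMod, gm w = k →
      ∑ i ∈ Finset.univ.filter (fun i => π i = w), wd i = Pr w / Module.finrank ℚ (fieldOfModuli E))
    (hbad : ∀ i, π i ∈ D.VbadMod → n i =
      -(-(ord (fieldOfModuli E) (π i).maximalIdeal jm : ℝ) * logNorm (fieldOfModuli E) (π i).maximalIdeal) /
        (2 * (l : ℝ) * Pr (π i)))
    (hgood : ∀ i, π i ∉ D.VbadMod → n i = 0) :
    ∑ i, wd i * n i =
      -(∑ v ∈ (vFbad_finite D).toFinset with gm (Thm311.Real.finBelow (E := E) v) = k, qTerm (E := E) v) /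
        (2 * (l : ℝ) * Module.finrank ℚ F) := by
  set B := (Thm311.Real.vbadMod_finite D).toFinset.filter (fun w => gm w = k) with hB
  -- pieces over good places contribute nothing
  have hsplit : ∑ i, wd i * n i = ∑ i ∈ Finset.univ.filter (fun i => π i ∈ D.VbadMod), wd i * n i := by
    rw [← Finset.sum_filter_add_sum_filter_not Finset.univ (fun i => π i ∈ D.VbadMod)]
    have h0 : ∑ i ∈ Finset.univ.filter (fun i => ¬ π i ∈ D.VbadMod), wd i * n i = 0 :=
      Finset.sum_eq_zero fun i hi => by
        rw [Finset.mem_filter] at hi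
        rw [hgood i hi.2, mul_zero]
    rw [h0, add_zero]
  rw [hsplit]
  have hmaps : ∀ i ∈ Finset.univ.filter (fun i => π i ∈ D.VbadMod), π i ∈ B := fun i hi => by
    rw [Finset.mem_filter] at hi
    exact Finset.mem_filter.mpr ⟨(vbadMod_toFinset_mem D _).mpr hi.2, hπ i⟩
  rw [← Finset.sum_fiberwise_of_maps_to hmaps]
  have hterm : ∀ w ∈ B,
      ∑ i ∈ (Finset.univ.filter (fun i => π i ∈ D.VbadMod)).filter (fun i => π i = w), wd i * n i =
        -(-(ord (fieldOfModuli E) w.maximalIdeal jm : ℝ) * logNorm (fieldOfModuli E) w.maximalIdeal) /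
          (2 * (l : ℝ) * Module.finrank ℚ (fieldOfModuli E)) := by
    intro w hw
    obtain ⟨hwbad', hgk⟩ := Finset.mem_filter.mp hw
    have hwbad : w ∈ D.VbadMod := (vbadMod_toFinset_mem D w).mp hwbad'
    have hfilt : (Finset.univ.filter (fun i => π i ∈ D.VbadMod)).filter (fun i => π i = w) =
        Finset.univ.filter (fun i => π i = w) := by
      ext i
      simp only [Finset.mem_filter, Finset.mem_univ, true_and]
      exact ⟨fun h => h.2, fun h => ⟨h ▸ hwbad, h⟩⟩
    rw [hfilt]
    have hn : ∀ i ∈ Finset.univ.filter (fun i => π i = w),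
        wd i * n i = wd i * (-(-(ord (fieldOfModuli E) w.maximalIdeal jm : ℝ) *
          logNorm (fieldOfModuli E) w.maximalIdeal) / (2 * (l : ℝ) * Pr w)) := by
      intro i hi
      rw [Finset.mem_filter] at hi
      rw [hbad i (hi.2 ▸ hwbad), hi.2]
    rw [Finset.sum_congr rfl hn, ← Finset.sum_mul, hmarg w hwbad hgk]
    have hP := hPr w hwbad
    have hM : (Module.finrank ℚ (fieldOfModuli E) : ℝ) ≠ 0 := by
      have : (0 : ℝ) < Module.finrank ℚ (fieldOfModuli E) := by exact_mod_cast Module.finrank_pos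
      exact this.ne'
    field_simp
  rw [Finset.sum_congr rfl hterm, ← Finset.sum_div, Finset.sum_neg_distrib, hB, sum_qTerm_fiber_mod D jm hjm gm k,
    finrank_rat_eq_mul (F := fieldOfModuli E) (K := F)]
  have hF : (0 : ℝ) < Module.finrank (fieldOfModuli E) F := by exact_mod_cast Module.finrank_pos
  have hM : (0 : ℝ) < Module.finrank ℚ (fieldOfModuli E) := by exact_mod_cast Module.finrank_pos
  field_simp

/-- **`−|log(q)| = −(1/2l)·log(q)` for a setting whose local `q`-volumes are weighted sums over pieces indexed by places of
`F_mod`** (the [IUTchIII] `𝕍 ≅ 𝕍_mod` indexing; abc-iut-c312-5's `Real.thetaIndexOfInitial D` has `V := V̲`): the `F_mod`-twin of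
`negLogQ_eq_neg_absLogq_of_pieces` — marginals `Σ_{i over w} wd_i = Pr(w)/[F_mod:ℚ]`, centres `= 2l`-th roots of the `q`-parameters
over bad `w` and units over good `w`, `P.qLocal j v_ℚ = Σ_i wd_i·n_i` ⟹ `P.negLogQ = −absLogq D`. PROVED.
[claim: Mochizuki2012, status: disputed] -/
theorem negLogQ_eq_neg_absLogq_of_pieces_mod (D : InitialThetaData F K Fbar E l Pb) (jm : fieldOfModuli E)
    (hjm : (jm : F) = E.j) {T : Thm311.ThetaIndex} [DecidableEq T.VQ] {S : Thm311.Situation T}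
    (P : Cor312.Setting S) (gm : FinitePlace (fieldOfModuli E) → T.VQ)
    (Pr : FinitePlace (fieldOfModuli E) → ℝ) (hPr : ∀ w ∈ D.VbadMod, Pr w ≠ 0)
    (I : Fin T.lstar → T.VQ → Type*) [∀ i vQ, Fintype (I i vQ)]
    (π : ∀ i vQ, I i vQ → FinitePlace (fieldOfModuli E)) (hπ : ∀ i vQ x, gm (π i vQ x) = vQ)
    (wd n : ∀ i vQ, I i vQ → ℝ)
    (hmarg : ∀ i vQ, ∀ w ∈ D.VbadMod, gm w = vQ →
      ∑ x ∈ Finset.univ.filter (fun x => π i vQ x = w), wd i vQ x = Pr w / Module.finrank ℚ (fieldOfModuli E))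
    (hbad : ∀ i vQ x, π i vQ x ∈ D.VbadMod → n i vQ x =
      -(-(ord (fieldOfModuli E) (π i vQ x).maximalIdeal jm : ℝ) * logNorm (fieldOfModuli E) (π i vQ x).maximalIdeal) /
        (2 * (l : ℝ) * Pr (π i vQ x)))
    (hgood : ∀ i vQ x, π i vQ x ∉ D.VbadMod → n i vQ x = 0)
    (hq : ∀ i vQ, P.qLocal (Cor312.Setting.labelSucc i) vQ = ∑ x, wd i vQ x * n i vQ x) :
    P.negLogQ = -absLogq D :=
  negLogQ_eq_neg_absLogq_of_local D P (gm ∘ Thm311.Real.finBelow (E := E)) fun i vQ => by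
    rw [hq i vQ]
    exact sum_pieces_eq_neg_qFiber_mod D jm hjm gm vQ (π i vQ) (hπ i vQ) (wd i vQ) (n i vQ) Pr hPr (hmarg i vQ)
      (hbad i vQ) (hgood i vQ)

end Summit.ABC.IUTFork.Cor312Prov

end
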